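import Literature.Geometry.Lorentzian.CarterFluxKernelBound
import Literature.Geometry.Lorentzian.CarterFarBarrierEnvelope
import Literature.Analysis.ODE.DeepBarrierKernelBound
import HarnessLib

/-!
# The Green-kernel bound for Carter's equation across a DEEP barrier, with its explicit constant
# (tortoise variable; no sign condition on `ωσ` — the superradiant regime)
(namespace `Literature.Geometry.Lorentzian.Kerr`.)

Carter's radial equation `u″ + (ω² − V(ρ x)) u = 0` (`V = Kerr.sepPotential M a ω m Λ`, `ρ` a tortoise
radius; Dafermos–Rodnianski–Shlapentokh-Rothman arXiv:1402.7034 §5.2.3) for the horizon- and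
infinity-normalised pair `u_𝓗, u_𝓘` (`‖u_𝓗‖ → 1`, `‖u_𝓗′‖ → |σ|`, flux `−σ` at `−∞`; `‖u_𝓘‖ → 1`,
`‖u_𝓘′‖ → |ω|`, flux `ω` at `+∞`; `σ = ω − mω₊ ≠ 0`, `ω ≠ 0`), in ANY sign regime of `ωσ` — in particular
the SUPERRADIANT one `ωσ < 0`, where the flux pairing behind `Kerr.fluxRegime_kernel_le` is void. The
substitute is tunnelling (`Literature.Analysis.ODE.kernel_le_of_deep_barrier`): GIVEN the census (one
barrier `[b₁, b₂]`, `Kerr.forbidden_interval`) and GIVEN, as explicit hypotheses on the monotone two-end real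
basis `g, d` of the barrier (`w₀ = g′(b₂)`), a DEPTH `D ≤ w₀`, reciprocal RATES `d(b₁) ≤ R_α w₀`,
`g(b₂) ≤ R_β w₀`, `g d ≤ R_m w₀` beyond a mark `x₀`, and a κ-free far start `ρ b₂ ≥ r₊ + ζ`, this file
proves

  `‖u_𝓗(x)‖ · ‖u_𝓘(x′)‖ ≤ K · ‖u_𝓗 u_𝓘′ − u_𝓘 u_𝓗′‖`,  `x ≤ x′`, `x₀ ≤ x′`,

with the EXPLICIT `K` of `kernel_le_of_deep_barrier` evaluated at the envelopes of the tree: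
`P_u² = 2·3⁹ + H_a/η²`, `P₁² = 3⁹σ² + H_a` on the cap `(−∞, b₁]` (`carter_envelope_H`,
`carter_envelope_H_deriv` here; `H_a = (Φ/η²)^16·e^{2ηL}·3^10σ²`, `L = (25/κ)log(2496Λ/(σ²M²))`,
`0 < η`, `η² ≤ σ²/4`, `η² ≤ 6/M²`), and `P_v² = (2 + 2|ω|R)² + B_ζ/η_f²`, `Q₁² = 2ω² + B_ζ` beyond `b₂`
(`carter_envelope_I(_deriv)_of_far_start`; `B_ζ = (Φ/η_f²)^16·e^{2η_f·50M²/ζ}·(η_f²(2 + 2|ω|R)² + 2ω²)`,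
any `0 < η_f` with `η_f² ≤ 6/M²`), provided the numerical depth `2P₁²Q₁² ≤ |σ||ω|D²`:

* `carter_envelope_H_deriv` — the derivative companion of `carter_envelope_H`;
* `carter_kernel_le_of_deep_barrier` — the bound above.

What is NOT here (the remaining analytic input of the Breitenlohner–Freedman-stable superradiant case of
the near-extremal cone kernel bound): the certification of depth and rates for Carter's coefficient
(`w₀ ≳ κ^{−ν}`, `ν² = Λ − 2amω − (2r₊ω)² + ¼`, against `P₁²Q₁²` polynomial in `Λ/κ`), the far start
`ρ b₂ ≥ r₊ + ζ(θ₁)`, and the cone bookkeeping turning `K` into `CΛ^Nκ^{−N}`.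

## References
* M. Dafermos, I. Rodnianski, Y. Shlapentokh-Rothman, arXiv:1402.7034 = Ann. of Math. 183 (2016),
  §§5.2.3, 6.3, 8 (key `DafermosRodnianskiShlapentokhrothman2014`).
* P. Hartman, *Ordinary Differential Equations* (SIAM Classics 38, 2002), Ch. XI §§2, 6 (key
  `Hartman2002`). The assembly is folklore.
-/

noncomputable section

open Filter Set Literature.Analysis.ODE
open scoped _root_.Topology _root_.ComplexConjugate

namespace Literature.Geometry.Lorentzian

namespace Kerr

section Envelope

variable {M a ω Λ : ℝ} {m : ℤ} {ρ : ℝ → ℝ} {u u₁ : ℝ → ℂ}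

-- adapted from Literature/Geometry/Lorentzian/CarterFluxEnvelopes.lean (`carter_envelope_H`)
/-- **Derivative envelope of the `𝓗⁺`-data solution before `b₁`.** Under the hypotheses of
`carter_envelope_H` (`ρ x_a = r₊ + σ²M³/(416Λ)`, `ρ b₁ ≤ 7M`, `0 < η`, `η² ≤ σ²/4`, `η² ≤ Φ`,
`ω² − V∘ρ ≤ Φ` everywhere and `≥ 0` on `(−∞, b₁]`), for `s ≤ b₁`:
`‖u′ s‖² ≤ 3⁹σ² + H_a`, `H_a = (Φ/η²)^16 · exp(2η·(25/κ)log(2496Λ/(σ²M²))) · 3^10σ²` (horizon zone: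
`carter_horizonZone_norm_sq_le`; beyond: the transported `η`-energy). [folklore] -/
theorem carter_envelope_H_deriv (hρ : IsTortoiseRadius M a ρ) (hMa : IsSubextremal M a)
    (hadm : IsAdmissibleTriple a ω m Λ) (hΛ : 1 ≤ Λ) (hσ : ω - m * horizonAngularVelocity M a ≠ 0)
    (hu : ∀ x, HasDerivAt u (u₁ x) x ∧
      HasDerivAt u₁ (-(((ω ^ 2 - sepPotential M a ω m Λ (ρ x) : ℝ) : ℂ) * u x)) x)
    (hlim : Tendsto (fun x ↦ ‖u x‖) atBot (𝓝 1))
    (hlim₁ : Tendsto (fun x ↦ ‖u₁ x‖) atBot (𝓝 |ω - m * horizonAngularVelocity M a|))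
    {xa b₁ η Φ : ℝ}
    (hxa : ρ xa = rPlus M a + (ω - m * horizonAngularVelocity M a) ^ 2 * M ^ 3 / (416 * Λ))
    (hb₁7 : ρ b₁ ≤ 7 * M) (hη : 0 < η)
    (hησ : η ^ 2 ≤ (ω - m * horizonAngularVelocity M a) ^ 2 / 4) (hηΦ : η ^ 2 ≤ Φ)
    (hΦ : ∀ s, ω ^ 2 - sepPotential M a ω m Λ (ρ s) ≤ Φ)
    (hpos : ∀ s, s ≤ b₁ → 0 ≤ ω ^ 2 - sepPotential M a ω m Λ (ρ s)) {s : ℝ} (hs : s ≤ b₁) :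
    ‖u₁ s‖ ^ 2 ≤ 3 ^ 9 * (ω - m * horizonAngularVelocity M a) ^ 2 +
      (Φ / η ^ 2) ^ 16 *
        Real.exp (2 * η * (25 / surfaceGravity M a *
          Real.log (2496 * Λ / ((ω - m * horizonAngularVelocity M a) ^ 2 * M ^ 2)))) *
        (3 ^ 10 * (ω - m * horizonAngularVelocity M a) ^ 2) := by
  set σ := ω - m * horizonAngularVelocity M a with hσdef
  set Ha := (Φ / η ^ 2) ^ 16 *
        Real.exp (2 * η * (25 / surfaceGravity M a * Real.log (2496 * Λ / (σ ^ 2 * M ^ 2)))) *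
        (3 ^ 10 * σ ^ 2) with hHa
  have hσ2 : 0 < σ ^ 2 := by positivity
  have hT0 : 0 ≤ (Φ / η ^ 2) ^ 16 := by
    have : 0 ≤ Φ / η ^ 2 := div_nonneg ((sq_nonneg η).trans hηΦ) (sq_nonneg η)
    positivity
  have hHa0 : 0 ≤ Ha := by positivity
  have hxa' : ρ xa - rPlus M a ≤ σ ^ 2 * M ^ 3 / (416 * Λ) := by rw [hxa]; ring_nf; exact le_rfl
  have hzone : ∀ t, t ≤ xa → ‖u t‖ ^ 2 ≤ 2 * 3 ^ 9 ∧ ‖u₁ t‖ ^ 2 ≤ 3 ^ 9 * σ ^ 2 := by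
    intro t ht
    have ht' : ρ t - rPlus M a ≤ σ ^ 2 * M ^ 3 / (416 * Λ) := by
      have := (hρ.strictMono hMa).monotone ht; linarith
    exact carter_horizonZone_norm_sq_le hρ hMa hadm hΛ hσ hu hlim hlim₁ ht'
  rcases le_or_gt s xa with hsa | hsa
  · have h1 := (hzone s hsa).2
    linarith
  · -- transport on `[xa, b₁]` from `xa`
    have hxab : xa < b₁ := hsa.trans_le hs
    have hEa : η ^ 2 * ‖u xa‖ ^ 2 + ‖u₁ xa‖ ^ 2 ≤ 3 ^ 10 * σ ^ 2 := by
      obtain ⟨h1, h2⟩ := hzone xa le_rfl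
      nlinarith [mul_le_mul hησ h1 (sq_nonneg _) (by positivity)]
    have hz : ∀ t ∈ Icc xa b₁, -η ^ 2 ≤ ω ^ 2 - sepPotential M a ω m Λ (ρ t) ∧
        ω ^ 2 - sepPotential M a ω m Λ (ρ t) ≤ Φ := fun t ht ↦
      ⟨le_trans (by nlinarith [sq_nonneg η]) (hpos t ht.2), hΦ t⟩
    have key := carter_tameZone_transport hρ hMa hadm hu hxab hη hηΦ hz (x := xa) (y := s)
      (left_mem_Icc.2 hxab.le) ⟨hsa.le, hs⟩
    have hlen : b₁ - xa ≤ 25 / surfaceGravity M a * Real.log (2496 * Λ / (σ ^ 2 * M ^ 2)) :=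
      hρ.tameZone_length_le hMa hσ hΛ hxa.ge hxab.le hb₁7
    have hexp : Real.exp (2 * η * (b₁ - xa)) ≤
        Real.exp (2 * η * (25 / surfaceGravity M a * Real.log (2496 * Λ / (σ ^ 2 * M ^ 2)))) :=
      Real.exp_le_exp.2 (mul_le_mul_of_nonneg_left hlen (by positivity))
    have hEs : η ^ 2 * ‖u s‖ ^ 2 + ‖u₁ s‖ ^ 2 ≤ Ha := by
      calc η ^ 2 * ‖u s‖ ^ 2 + ‖u₁ s‖ ^ 2
          ≤ (Φ / η ^ 2) ^ 16 * Real.exp (2 * η * (b₁ - xa)) * (η ^ 2 * ‖u xa‖ ^ 2 + ‖u₁ xa‖ ^ 2) := key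
        _ ≤ (Φ / η ^ 2) ^ 16 *
            Real.exp (2 * η * (25 / surfaceGravity M a * Real.log (2496 * Λ / (σ ^ 2 * M ^ 2)))) *
            (3 ^ 10 * σ ^ 2) := by gcongr
    have h1 : ‖u₁ s‖ ^ 2 ≤ Ha := le_trans (le_add_of_nonneg_left (by positivity)) hEs
    nlinarith

end Envelope

section Kernel

variable {M a ω Λ : ℝ} {m : ℤ} {ρ : ℝ → ℝ} {uH uH₁ uI uI₁ : ℝ → ℂ}

set_option maxHeartbeats 400000 in
-- long statement with the explicit constant; the proof is plumbing
/-- **The deep-barrier kernel bound for Carter's equation with its explicit constant.** For a tortoise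
radius `ρ`, an admissible triple with `Λ ≥ 1`, `σ = ω − mω₊ ≠ 0`, `ω ≠ 0` (no sign condition on `ωσ`),
the census, the horizon- and infinity-data pair `u_𝓗, u_𝓘` of Carter's equation, a cap exponent `η`
(`0 < η`, `η² ≤ σ²/4`, `η² ≤ 6/M²`), a far exponent `η_f` (`0 < η_f`, `η_f² ≤ 6/M²`), and data
`ζ > 0`, `x₀`, `D > 0`, `R_α, R_β, R_m ≥ 0` such that the forbidden set is non-empty and, whenever it
equals `[b₁, b₂]`: `ρ b₂ ≥ r₊ + ζ` and every monotone two-end real basis `g, d` of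
`y″ = −(ω² − V∘ρ) y` on `[b₁, b₂]` (`w₀ = g′(b₂)`) has `D ≤ w₀`, `d(b₁) ≤ R_α w₀`, `g(b₂) ≤ R_β w₀` and
`g d ≤ R_m w₀` on `[b₁, b₂] ∩ [x₀, ∞)`; and provided `2P₁²Q₁² ≤ |σ||ω|D²` with `P₁² = 3⁹σ² + H_a`,
`Q₁² = 2ω² + B_ζ`: for all `x ≤ x′` with `x₀ ≤ x′`,
`‖u_𝓗 x‖‖u_𝓘 x′‖ ≤ K(P_u, P_v, P₁, Q₁, σ, ω, R_α, R_β, R_m)·‖W(x)‖`, `K` the constant of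
`kernel_le_of_deep_barrier`, `P_u² = 2·3⁹ + H_a/η²`, `P_v² = (2 + 2|ω|R)² + B_ζ/η_f²`. [folklore] -/
theorem carter_kernel_le_of_deep_barrier (hρ : IsTortoiseRadius M a ρ) (hMa : IsSubextremal M a)
    (hadm : IsAdmissibleTriple a ω m Λ) (hΛ : 1 ≤ Λ)
    (hσ : ω - m * horizonAngularVelocity M a ≠ 0) (hω : ω ≠ 0)
    (hord : (Ioi (rPlus M a) ∩ {r : ℝ | ω ^ 2 ≤ sepPotential M a ω m Λ r}).OrdConnected)
    (hu : ∀ x, HasDerivAt uH (uH₁ x) x ∧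
      HasDerivAt uH₁ (-(((ω ^ 2 - sepPotential M a ω m Λ (ρ x) : ℝ) : ℂ) * uH x)) x)
    (hv : ∀ x, HasDerivAt uI (uI₁ x) x ∧
      HasDerivAt uI₁ (-(((ω ^ 2 - sepPotential M a ω m Λ (ρ x) : ℝ) : ℂ) * uI x)) x)
    (hH0 : Tendsto (fun x ↦ ‖uH x‖) atBot (𝓝 1))
    (hH1 : Tendsto (fun x ↦ ‖uH₁ x‖) atBot (𝓝 |ω - m * horizonAngularVelocity M a|))
    (hHf : ∀ x, (starRingEnd ℂ (uH x) * uH₁ x).im = -(ω - m * horizonAngularVelocity M a))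
    (hI0 : Tendsto (fun x ↦ ‖uI x‖) atTop (𝓝 1))
    (hI1 : Tendsto (fun x ↦ ‖uI₁ x‖) atTop (𝓝 |ω|))
    (hIf : ∀ x, (starRingEnd ℂ (uI x) * uI₁ x).im = ω)
    {η ηf : ℝ} (hη : 0 < η) (hησ : η ^ 2 ≤ (ω - m * horizonAngularVelocity M a) ^ 2 / 4)
    (hηM : η ^ 2 ≤ 6 / M ^ 2) (hηf : 0 < ηf) (hηfM : ηf ^ 2 ≤ 6 / M ^ 2)
    {ζ x₀ D Rα Rβ Rm : ℝ} (hζ : 0 < ζ) (hD : 0 < D) (hRα : 0 ≤ Rα) (hRβ : 0 ≤ Rβ) (hRm : 0 ≤ Rm)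
    (hbar : ∃ s, ω ^ 2 - sepPotential M a ω m Λ (ρ s) ≤ 0)
    (hgeom : ∀ b₁ b₂ : ℝ, b₁ ≤ b₂ →
      {s | ω ^ 2 - sepPotential M a ω m Λ (ρ s) ≤ 0} = Icc b₁ b₂ →
        rPlus M a + ζ ≤ ρ b₂ ∧
        ∀ g g' d d' : ℝ → ℝ, ∀ w₀ : ℝ,
          (∀ x ∈ Icc b₁ b₂, HasDerivAt g (g' x) x ∧
            HasDerivAt g' (-(ω ^ 2 - sepPotential M a ω m Λ (ρ x)) * g x) x) →
          (∀ x ∈ Icc b₁ b₂, HasDerivAt d (d' x) x ∧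
            HasDerivAt d' (-(ω ^ 2 - sepPotential M a ω m Λ (ρ x)) * d x) x) →
          g b₁ = 1 → g' b₁ = 0 → d b₂ = 1 → d' b₂ = 0 → g' b₂ = w₀ →
          (∀ x ∈ Icc b₁ b₂, 1 ≤ g x ∧ 0 ≤ g' x ∧ 1 ≤ d x ∧ d' x ≤ 0) →
          MonotoneOn g (Icc b₁ b₂) → AntitoneOn d (Icc b₁ b₂) →
          (∀ x ∈ Icc b₁ b₂, g x * d' x - g' x * d x = -w₀) →
            D ≤ w₀ ∧ d b₁ ≤ Rα * w₀ ∧ g b₂ ≤ Rβ * w₀ ∧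
              ∀ x ∈ Icc b₁ b₂, x₀ ≤ x → g x * d x ≤ Rm * w₀)
    {σ Φ R L Ha Bζ Pu Pv P₁ Q₁ : ℝ} (hσdef : σ = ω - m * horizonAngularVelocity M a)
    (hΦdef : Φ = ω ^ 2 + 6 * Λ / M ^ 2)
    (hRdef : R = max (7 * M) (max (Real.sqrt (12 * Λ) / |ω|) (1 / (M * ω ^ 2))))
    (hLdef : L = 25 / surfaceGravity M a * Real.log (2496 * Λ / (σ ^ 2 * M ^ 2)))
    (hHadef : Ha = (Φ / η ^ 2) ^ 16 * Real.exp (2 * η * L) * (3 ^ 10 * σ ^ 2))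
    (hBdef : Bζ = (Φ / ηf ^ 2) ^ 16 * Real.exp (2 * ηf * (50 * M ^ 2 / ζ)) *
      (ηf ^ 2 * (2 + 2 * |ω| * R) ^ 2 + 2 * ω ^ 2))
    (hPudef : Pu = Real.sqrt (2 * 3 ^ 9 + Ha / η ^ 2))
    (hPvdef : Pv = Real.sqrt ((2 + 2 * |ω| * R) ^ 2 + Bζ / ηf ^ 2))
    (hP₁def : P₁ = Real.sqrt (3 ^ 9 * σ ^ 2 + Ha)) (hQ₁def : Q₁ = Real.sqrt (2 * ω ^ 2 + Bζ))
    (hdeep : 2 * (3 ^ 9 * σ ^ 2 + Ha) * (2 * ω ^ 2 + Bζ) ≤ |σ| * |ω| * D ^ 2)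
    {x x' : ℝ} (hxx' : x ≤ x') (hx₀ : x₀ ≤ x') :
    ‖uH x‖ * ‖uI x'‖ ≤
      (3 * Pu ^ 2 / |σ| + 3 * Pv ^ 2 / |ω| + 2 * Pu * Pv / Real.sqrt (|ω| * |σ|) +
        Pu * (2 * Q₁ * Rβ / Real.sqrt (|ω| * |σ|) + 2 * P₁ * Rα / |σ|) +
        Pv * (2 * Q₁ * Rβ / |ω| + 2 * P₁ * Rα / Real.sqrt (|ω| * |σ|)) +
        (2 * Q₁ ^ 2 * Rβ ^ 2 / |ω| + 2 * Rm + 2 * P₁ * Q₁ * (Rα * Rβ) / Real.sqrt (|ω| * |σ|) +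
          2 * P₁ ^ 2 * Rα ^ 2 / |σ|)) * ‖uH x * uI₁ x - uI x * uH₁ x‖ := by
  subst hσdef hLdef hRdef hΦdef
  have hM : 0 < M := hMa.pos
  have haM : |a| ≤ M := le_of_lt hMa
  set σ := ω - (m : ℝ) * horizonAngularVelocity M a with hσ'
  set φ : ℝ → ℝ := fun s ↦ ω ^ 2 - sepPotential M a ω m Λ (ρ s) with hφ
  have hcont : Continuous φ := continuous_iff_continuousAt.2 fun s ↦
    (hρ.hasDerivAt_omega_sq_sub_sepPotential hMa ω m Λ s).continuousAt
  -- scalar facts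
  have hη2 : 0 < η ^ 2 := by positivity
  have hηf2 : 0 < ηf ^ 2 := by positivity
  have hσ2 : 0 < σ ^ 2 := by positivity
  have hω2 : 0 < ω ^ 2 := by positivity
  have hΦ6 : 6 / M ^ 2 ≤ ω ^ 2 + 6 * Λ / M ^ 2 := by
    have h1 : 6 / M ^ 2 ≤ 6 * Λ / M ^ 2 := by
      rw [div_le_div_iff_of_pos_right (by positivity)]; linarith
    linarith [hω2.le]
  have hΦη : η ^ 2 ≤ ω ^ 2 + 6 * Λ / M ^ 2 := hηM.trans hΦ6
  have hΦηf : ηf ^ 2 ≤ ω ^ 2 + 6 * Λ / M ^ 2 := hηfM.trans hΦ6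
  have hΦall : ∀ s, ω ^ 2 - sepPotential M a ω m Λ (ρ s) ≤ ω ^ 2 + 6 * Λ / M ^ 2 := fun s ↦
    coeff_le_of_admissible hM haM hadm hΛ (hρ.rPlus_lt s).le
  have hr2 : rPlus M a ≤ 2 * M := rPlus_le_two_mul_self hM.le a
  have h7p : rPlus M a < 7 * M := by linarith
  have hxap : rPlus M a < rPlus M a + σ ^ 2 * M ^ 3 / (416 * Λ) :=
    lt_add_of_pos_right _ (by positivity)
  obtain ⟨xa, hxa⟩ := hρ.exists_apply_eq hxap
  obtain ⟨x₇, hx₇⟩ := hρ.exists_apply_eq h7p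
  -- the barrier
  rcases forbidden_interval hρ hMa hadm hΛ hσ hω hord hxa with hposall | ⟨b₁, b₂, -, hb, hb₁7, -, hF, hφ₁, hφ₂⟩
  · exfalso
    obtain ⟨s, hs⟩ := hbar
    exact absurd (hposall s) (not_lt.2 hs)
  have hout : ∀ s, s ∉ Icc b₁ b₂ → 0 < φ s := by
    intro s hs
    by_contra h
    push Not at h
    have : s ∈ {s | φ s ≤ 0} := h
    rw [hF] at this
    exact hs this
  have hposH : ∀ s, s ≤ b₁ → 0 ≤ ω ^ 2 - sepPotential M a ω m Λ (ρ s) := by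
    intro s hs
    rcases hs.eq_or_lt with h | h
    · rw [h]; exact le_of_eq hφ₁.symm
    · exact (hout s fun hm ↦ absurd hm.1 (not_le.2 h)).le
  have hposI : ∀ s, b₂ ≤ s → 0 ≤ ω ^ 2 - sepPotential M a ω m Λ (ρ s) := by
    intro s hs
    rcases hs.eq_or_lt with h | h
    · rw [← h]; exact le_of_eq hφ₂.symm
    · exact (hout s fun hm ↦ absurd hm.2 (not_le.2 h)).le
  have hφneg : ∀ s ∈ Icc b₁ b₂, φ s ≤ 0 := by
    intro s hs
    have : s ∈ {s | φ s ≤ 0} := by rw [hF]; exact hs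
    exact this
  obtain ⟨hZ₂, hbasisR⟩ := hgeom b₁ b₂ hb hF
  -- the envelopes (squares)
  set T := (ω ^ 2 + 6 * Λ / M ^ 2) / η ^ 2 with hT
  set E := Real.exp (2 * η * (25 / surfaceGravity M a * Real.log (2496 * Λ / (σ ^ 2 * M ^ 2)))) with hE
  have hHa' : Ha = T ^ 16 * E * (3 ^ 10 * σ ^ 2) := by rw [hHadef]
  have hHa0 : 0 ≤ Ha := by rw [hHa']; positivity
  set Pf := 2 + 2 * |ω| * max (7 * M) (max (Real.sqrt (12 * Λ) / |ω|) (1 / (M * ω ^ 2))) with hPf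
  have hR0 : 0 ≤ max (7 * M) (max (Real.sqrt (12 * Λ) / |ω|) (1 / (M * ω ^ 2))) :=
    le_trans (by positivity) (le_max_left _ _)
  have hPf0 : 0 ≤ Pf := by positivity
  have hBζ' : Bζ = ((ω ^ 2 + 6 * Λ / M ^ 2) / ηf ^ 2) ^ 16 * Real.exp (2 * ηf * (50 * M ^ 2 / ζ)) *
      (ηf ^ 2 * Pf ^ 2 + 2 * ω ^ 2) := by rw [hBdef]
  have hBζ0 : 0 ≤ Bζ := by rw [hBζ']; positivity
  have hPu2 : Pu ^ 2 = 2 * 3 ^ 9 + Ha / η ^ 2 := by rw [hPudef, Real.sq_sqrt (by positivity)]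
  have hPv2 : Pv ^ 2 = Pf ^ 2 + Bζ / ηf ^ 2 := by rw [hPvdef, Real.sq_sqrt (by positivity)]
  have hP₁2 : P₁ ^ 2 = 3 ^ 9 * σ ^ 2 + Ha := by rw [hP₁def, Real.sq_sqrt (by positivity)]
  have hQ₁2 : Q₁ ^ 2 = 2 * ω ^ 2 + Bζ := by rw [hQ₁def, Real.sq_sqrt (by positivity)]
  have hPu0 : 0 ≤ Pu := by rw [hPudef]; exact Real.sqrt_nonneg _
  have hPv0 : 0 ≤ Pv := by rw [hPvdef]; exact Real.sqrt_nonneg _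
  have hP₁0 : 0 ≤ P₁ := by rw [hP₁def]; exact Real.sqrt_nonneg _
  have hQ₁0 : 0 ≤ Q₁ := by rw [hQ₁def]; exact Real.sqrt_nonneg _
  have hPu : ∀ s, s ≤ b₁ → ‖uH s‖ ≤ Pu := by
    intro s hs
    have h := carter_envelope_H hρ hMa hadm hΛ hσ hu hH0 hH1 hxa hb₁7 hη hησ hΦη hΦall hposH hs
    rw [← hHa', ← hPu2] at h
    exact le_of_pow_le_pow_left₀ two_ne_zero hPu0 h
  have hP₁ : ‖uH₁ b₁‖ ≤ P₁ := by
    have h := carter_envelope_H_deriv hρ hMa hadm hΛ hσ hu hH0 hH1 hxa hb₁7 hη hησ hΦη hΦall hposH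
      (le_refl b₁)
    rw [← hHa', ← hP₁2] at h
    exact le_of_pow_le_pow_left₀ two_ne_zero hP₁0 h
  have hPv : ∀ s, b₂ ≤ s → ‖uI s‖ ≤ Pv := by
    intro s hs
    have h := carter_envelope_I_of_far_start hρ hMa hadm hω hv hI0 hI1 hx₇ hζ hZ₂ hηf hΦηf hΦall hposI hs
    rw [← hPf, ← hBζ', ← hPv2] at h
    exact le_of_pow_le_pow_left₀ two_ne_zero hPv0 h
  have hQ₁ : ‖uI₁ b₂‖ ≤ Q₁ := by
    have h := carter_envelope_I_deriv_of_far_start hρ hMa hadm hω hv hI0 hI1 hx₇ hζ hZ₂ hηf hΦηf hΦall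
      hposI (le_refl b₂)
    rw [← hPf, ← hBζ', ← hQ₁2] at h
    exact le_of_pow_le_pow_left₀ two_ne_zero hQ₁0 h
  -- the basis hypothesis in the form of `kernel_le_of_deep_barrier`
  have hbasis : ∀ g g' d d' : ℝ → ℝ, ∀ w₀ : ℝ,
      (∀ x ∈ Icc b₁ b₂, HasDerivAt g (g' x) x ∧ HasDerivAt g' (-φ x * g x) x) →
      (∀ x ∈ Icc b₁ b₂, HasDerivAt d (d' x) x ∧ HasDerivAt d' (-φ x * d x) x) →
      g b₁ = 1 → g' b₁ = 0 → d b₂ = 1 → d' b₂ = 0 → g' b₂ = w₀ →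
      (∀ x ∈ Icc b₁ b₂, 1 ≤ g x ∧ 0 ≤ g' x ∧ 1 ≤ d x ∧ d' x ≤ 0) →
      MonotoneOn g (Icc b₁ b₂) → AntitoneOn d (Icc b₁ b₂) →
      (∀ x ∈ Icc b₁ b₂, g x * d' x - g' x * d x = -w₀) →
        2 * P₁ ^ 2 * Q₁ ^ 2 ≤ |σ| * |ω| * w₀ ^ 2 ∧ d b₁ ≤ Rα * w₀ ∧ g b₂ ≤ Rβ * w₀ ∧
          ∀ x ∈ Icc b₁ b₂, x₀ ≤ x → g x * d x ≤ Rm * w₀ := by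
    intro g g' d d' w₀ hg hd hgα hg'α hdβ hd'β hg'β hsign hgm hdm hW
    obtain ⟨hDw, h2, h3, h4⟩ := hbasisR g g' d d' w₀ hg hd hgα hg'α hdβ hd'β hg'β hsign hgm hdm hW
    refine ⟨?_, h2, h3, h4⟩
    have hw2 : D ^ 2 ≤ w₀ ^ 2 := pow_le_pow_left₀ hD.le hDw 2
    calc 2 * P₁ ^ 2 * Q₁ ^ 2 = 2 * (3 ^ 9 * σ ^ 2 + Ha) * (2 * ω ^ 2 + Bζ) := by rw [hP₁2, hQ₁2]
      _ ≤ |σ| * |ω| * D ^ 2 := hdeep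
      _ ≤ |σ| * |ω| * w₀ ^ 2 := by gcongr
  exact kernel_le_of_deep_barrier (φ := φ) hu hv hHf hIf hσ hω hb hcont hφneg hPu hPv hP₁ hQ₁ hRα hRβ
    hRm hbasis hxx' hx₀

end Kernel

end Kerr

end Literature.Geometry.Lorentzian

end
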